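import Literature.AlgebraicGeometry.FormalGeometry.WittGETowerSections
import Literature.AlgebraicGeometry.Morphisms.FormalFunctionsCechProofs
import Mathlib.AlgebraicGeometry.Morphisms.Proper
import Mathlib.AlgebraicGeometry.Noetherian
import HarnessLib

/-!
# The `p`-adic thickenings `X_n ⊆ 𝒳`: equations, points of the special fibre, properness

Helper file for stub `stub_pushforwardTransport` (line `chow-zariski-pushforward` of the crux
`PadicSemiregularLift.FormalVectorBundlesAlgebraize`, stmt-HodgeConjecture-14106). For a
`W(k)`-scheme `𝒳` (`k` a perfect field of characteristic `p`, `W = W(k)`):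

* `thickeningι_cutOut`, `thickeningMap_cutOut` — on affine opens, `X_n ↪ 𝒳` and `X_m ↪ X_n` are
  surjective on functions with kernels generated by `p^n`, resp. `p^m` (tree
  `ker_app_le_span_of_isPullback`, `natCast_pow_eq_zero_thickening`);
* `mul_p_injective_sections`, `exists_eq_p_mul_of_forall_affine` — for `𝒳` flat over `W`, `p` is
  a non-zero-divisor on `Γ(𝒳, V)` and divisibility by `p` is local (tree `Sections.isSMulRegular`);
* `range_thickeningι` — the image of `X_n → 𝒳` (`n ≥ 1`) is the *special fibre*: the points over
  the closed point of `Spec W`; `not_isUnit_germ_p` — `p` is not a unit in the local rings there;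
* `eq_empty_of_isClosed_of_disjoint_specialFibre` — **GW II Lemma 24.96**: for `𝒳` proper over
  `W`, a closed subset missing the special fibre is empty;
* `isNoetherianRing_sections`, `compactSpace_left` — `𝒳` proper over `W` is locally Noetherian and
  quasi-compact.

Everything is proved; no definitions.

Provenance: Literature home (family `hodge`, layer `Literature/AlgebraicGeometry/FormalGeometry`, namespace
`Literature.AlgebraicGeometry.FormalGeometry.WittGrothendieckExistence…`) of the Summits-side
`Theorems/PadicSemiregularLiftFormalVectorBundlesAlgebraizeThickenings` (route `PadicSemiregularLift` / `AnchorTransport`,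
Grothendieck existence for vector bundles over `W(k)`), which `Literature/` may not import; theorems only, no
named fact, no definition. Lane `lit-hodgefound`, seat p20.
-/

noncomputable section

open CategoryTheory CategoryTheory.Limits _root_.AlgebraicGeometry TopologicalSpace Opposite
open Literature.AlgebraicGeometry.Motives Literature.AlgebraicGeometry.Motives.WittScheme
open Literature.AlgebraicGeometry.Morphisms
open Literature.AlgebraicGeometry.FormalGeometry.WittGrothendieckExistence.PadicPridhamSemiregularity

universe u

namespace Literature.AlgebraicGeometry.FormalGeometry.WittGrothendieckExistence.FormalVectorBundlesAlgebraize

/-- Restriction of a natural-number global function to an open is the same natural number. [cite: GortzWedhorn2023, proof of Thm. 24.94 and Prop. 24.95 (pp. 566–567), auxiliary step] -/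
theorem map_natCast' {Y : Scheme.{u}} {U V : Y.Opens} (i : U ⟶ V) (q : ℕ) :
    Y.presheaf.map i.op (q : Γ(Y, V)) = (q : Γ(Y, U)) :=
  map_natCast _ _

section Tower

variable {p : ℕ} [Fact p.Prime] {k : Type u} [Field k] (𝒳 : SchemeOver (WittVector p k))

/-! ### The closed immersions of the tower are cut out by powers of `p` -/

/-- `X_n ↪ 𝒳` is a closed immersion (base change of `Spec (W ↠ W_n)`). [cite: GortzWedhorn2023, proof of Thm. 24.94 and Prop. 24.95 (pp. 566–567), auxiliary step] -/
theorem isClosedImmersion_thickeningι (n : ℕ) : IsClosedImmersion (thickeningι 𝒳 n) :=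
  MorphismProperty.of_isPullback (IsPullback.of_hasPullback 𝒳.hom
    (Spec.map (CommRingCat.ofHom (algebraMap (WittVector p k) (wittQuot p k n))))).flip
    (IsClosedImmersion.spec_of_surjective _ Ideal.Quotient.mk_surjective)

/-- **`X_n ↪ 𝒳` is cut out by `p^n`**: on an affine open `U`, `Γ(𝒳, U) → Γ(X_n, U ∩ X_n)` is
surjective and its kernel is generated by `p^n`. [cite: GortzWedhorn2023, proof of Thm. 24.94 and Prop. 24.95 (pp. 566–567), auxiliary step] -/
theorem thickeningι_cutOut (n : ℕ) {U : 𝒳.left.Opens} (hU : IsAffineOpen U) :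
    Function.Surjective ((thickeningι 𝒳 n).app U) ∧
      ∀ r : Γ(𝒳.left, U), (thickeningι 𝒳 n).app U r = 0 ↔
        ∃ c : Γ(𝒳.left, U), r = 𝒳.left.presheaf.map (homOfLE le_top).op
          ((p ^ n : ℕ) : Γ(𝒳.left, ⊤)) * c := by
  haveI := isClosedImmersion_thickeningι 𝒳 n
  refine ⟨(thickeningι 𝒳 n).app_surjective U hU, fun r => ?_⟩
  rw [map_natCast']
  constructor
  · intro hr
    have hker : RingHom.ker ((thickeningι 𝒳 n).app U).hom ≤
        Ideal.span {((p ^ n : ℕ) : Γ(𝒳.left, U))} :=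
      ker_app_le_span_of_isPullback Ideal.Quotient.mk_surjective (p ^ n)
        (by
          rw [Ideal.mk_ker, Ideal.span_singleton_pow, Nat.cast_pow])
        (IsPullback.of_hasPullback 𝒳.hom
          (Spec.map (CommRingCat.ofHom (algebraMap (WittVector p k) (wittQuot p k n))))) hU
    have hr' : r ∈ RingHom.ker ((thickeningι 𝒳 n).app U).hom := hr
    obtain ⟨c, hc⟩ := Ideal.mem_span_singleton'.mp (hker hr')
    exact ⟨c, by rw [← hc, mul_comm]⟩
  · rintro ⟨c, rfl⟩
    rw [map_mul, map_natCast, natCast_pow_eq_zero_thickening, zero_mul]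

/-- `p^n` vanishes on `X_n` (on global functions of `𝒳`). [cite: GortzWedhorn2023, proof of Thm. 24.94 and Prop. 24.95 (pp. 566–567), auxiliary step] -/
theorem thickeningι_app_top_natCast_pow (n : ℕ) :
    (thickeningι 𝒳 n).app ⊤ ((p ^ n : ℕ) : Γ(𝒳.left, ⊤)) = 0 := by
  rw [map_natCast, natCast_pow_eq_zero_thickening]

/-- **`X_m ↪ X_n` is cut out by `p^m`**: on an affine open `U ⊆ X_n`,
`Γ(X_n, U) → Γ(X_m, U ∩ X_m)` is surjective and its kernel is generated by `p^m`. [cite: GortzWedhorn2023, proof of Thm. 24.94 and Prop. 24.95 (pp. 566–567), auxiliary step] -/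
theorem thickeningMap_cutOut {m n : ℕ} (h : m ≤ n) {U : (thickening 𝒳 n).left.Opens}
    (hU : IsAffineOpen U) :
    Function.Surjective ((thickeningMap 𝒳 h).app U) ∧
      ∀ r : Γ((thickening 𝒳 n).left, U), (thickeningMap 𝒳 h).app U r = 0 ↔
        ∃ c : Γ((thickening 𝒳 n).left, U), r = (thickening 𝒳 n).left.presheaf.map
          (homOfLE le_top).op ((p ^ m : ℕ) : Γ((thickening 𝒳 n).left, ⊤)) * c := by
  haveI := isClosedImmersion_thickeningMap 𝒳 h
  refine ⟨(thickeningMap 𝒳 h).app_surjective U hU, fun r => ?_⟩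
  rw [map_natCast']
  constructor
  · intro hr
    have hr' : r ∈ RingHom.ker ((thickeningMap 𝒳 h).app U).hom := hr
    obtain ⟨c, hc⟩ := Ideal.mem_span_singleton'.mp (ker_app_thickeningMap_le 𝒳 h hU hr')
    exact ⟨c, by rw [← hc, mul_comm]⟩
  · rintro ⟨c, rfl⟩
    rw [map_mul, map_natCast, natCast_pow_eq_zero_thickening, zero_mul]

/-- `p^m` vanishes on `X_m` (on global functions of `X_n`). [cite: GortzWedhorn2023, proof of Thm. 24.94 and Prop. 24.95 (pp. 566–567), auxiliary step] -/
theorem thickeningMap_app_top_natCast_pow {m n : ℕ} (h : m ≤ n) :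
    (thickeningMap 𝒳 h).app ⊤ ((p ^ m : ℕ) : Γ((thickening 𝒳 n).left, ⊤)) = 0 := by
  rw [map_natCast, natCast_pow_eq_zero_thickening]

end Tower

/-! ### Flatness over `W`: `p` is a non-zero-divisor on functions -/

section Flat

variable {p : ℕ} [Fact p.Prime] {k : Type u} [Field k] [CharP k p] (𝒳 : SchemeOver (WittVector p k))

/-- `p ≠ 0` is a non-zero-divisor of `W(k)`. [cite: GortzWedhorn2023, proof of Thm. 24.94 and Prop. 24.95 (pp. 566–567), auxiliary step] -/
theorem natCast_p_mem_nonZeroDivisors : ((p : ℕ) : WittVector p k) ∈ nonZeroDivisors _ :=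
  mem_nonZeroDivisors_of_ne_zero (Nat.cast_ne_zero.mpr (Fact.out : p.Prime).ne_zero)

/-- **For `𝒳` flat over `W`, multiplication by `p` is injective on `Γ(𝒳, V)`** for every open `V`
(tree `Sections.isSMulRegular`). [cite: GortzWedhorn2023, proof of Thm. 24.94 and Prop. 24.95 (pp. 566–567), auxiliary step] -/
theorem mul_p_injective_sections [Flat 𝒳.hom] (V : 𝒳.left.Opens) (s : Γ(𝒳.left, V))
    (hs : (p : Γ(𝒳.left, V)) * s = 0) : s = 0 := by
  have hreg := Sections.isSMulRegular 𝒳.hom (natCast_p_mem_nonZeroDivisors (k := k)) V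
  have hs' : ((p : ℕ) : WittVector p k) • (show Sections 𝒳.hom V from s) =
      ((p : ℕ) : WittVector p k) • (0 : Sections 𝒳.hom V) := by
    rw [smul_zero, Algebra.smul_def, Sections.algebraMap_apply, map_natCast, map_natCast]
    exact hs
  exact hreg hs'

/-- Powers of `p` are non-zero-divisors on `Γ(𝒳, V)` for `𝒳` flat over `W`. [cite: GortzWedhorn2023, proof of Thm. 24.94 and Prop. 24.95 (pp. 566–567), auxiliary step] -/
theorem mul_p_pow_injective_sections [Flat 𝒳.hom] (V : 𝒳.left.Opens) (n : ℕ)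
    (s : Γ(𝒳.left, V)) (hs : (p : Γ(𝒳.left, V)) ^ n * s = 0) : s = 0 := by
  induction n generalizing s with
  | zero => simpa using hs
  | succ n ih =>
    rw [pow_succ, mul_assoc] at hs
    exact mul_p_injective_sections 𝒳 V s (ih _ hs)

/-- **Divisibility by `p` is local** on a `W`-flat `𝒳`: a function divisible by `p` on every
affine open below `V` is divisible by `p` on `V` (tree `Sections.exists_eq_smul_of_forall_affine`). [cite: GortzWedhorn2023, proof of Thm. 24.94 and Prop. 24.95 (pp. 566–567), auxiliary step] -/
theorem exists_eq_p_mul_of_forall_affine [Flat 𝒳.hom] {V : 𝒳.left.Opens} (t : Γ(𝒳.left, V))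
    (h : ∀ W : 𝒳.left.affineOpens, ∀ hW : (W : 𝒳.left.Opens) ≤ V,
      ∃ c : Γ(𝒳.left, W), 𝒳.left.presheaf.map (homOfLE hW).op t = (p : Γ(𝒳.left, W)) * c) :
    ∃ c : Γ(𝒳.left, V), t = (p : Γ(𝒳.left, V)) * c := by
  have hreg := fun W => Sections.isSMulRegular 𝒳.hom (natCast_p_mem_nonZeroDivisors (k := k)) W
  obtain ⟨c, hc⟩ := Sections.exists_eq_smul_of_forall_affine 𝒳.hom hreg
    (show Sections 𝒳.hom V from t) fun W hW => by
      obtain ⟨c, hc⟩ := h W hW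
      refine ⟨c, ?_⟩
      rw [Algebra.smul_def, Sections.algebraMap_apply, map_natCast, map_natCast]
      exact hc
  refine ⟨c, ?_⟩
  rw [Algebra.smul_def, Sections.algebraMap_apply, map_natCast, map_natCast] at hc
  exact hc

end Flat

/-! ### Points of the special fibre -/

section Points

variable {p : ℕ} [Fact p.Prime] {k : Type u} [Field k] [CharP k p] [PerfectRing k p]

/-- The primes of `W(k)` containing `p` reduce to the closed point. [cite: GortzWedhorn2023, proof of Thm. 24.94 and Prop. 24.95 (pp. 566–567), auxiliary step] -/
theorem asIdeal_eq_closedPoint_of_mem (x : PrimeSpectrum (WittVector p k))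
    (hx : (p : WittVector p k) ∈ x.asIdeal) : x = IsLocalRing.closedPoint (WittVector p k) := by
  have hne : x.asIdeal ≠ ⊥ := fun h => by
    rw [h, Ideal.mem_bot] at hx
    exact Nat.cast_ne_zero.mpr (Fact.out : p.Prime).ne_zero hx
  haveI : x.asIdeal.IsMaximal := IsPrime.to_maximal_ideal hne
  exact PrimeSpectrum.ext (IsLocalRing.eq_maximalIdeal inferInstance)

/-- `p` lies in the maximal ideal of `W(k)`. [cite: GortzWedhorn2023, proof of Thm. 24.94 and Prop. 24.95 (pp. 566–567), auxiliary step] -/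
theorem natCast_p_mem_closedPoint :
    (p : WittVector p k) ∈ (IsLocalRing.closedPoint (WittVector p k)).asIdeal :=
  (WittVector.irreducible (k := k) p).not_isUnit

variable (𝒳 : SchemeOver (WittVector p k))

/-- **The image of `X_n → 𝒳` (`n ≠ 0`) is the special fibre**: the points of `𝒳` over the
closed point of `Spec W`. [cite: GortzWedhorn2023, proof of Thm. 24.94 and Prop. 24.95 (pp. 566–567), auxiliary step] -/
theorem range_thickeningι {n : ℕ} (hn : n ≠ 0) :
    Set.range (thickeningι 𝒳 n).base =
      𝒳.hom.base ⁻¹' {IsLocalRing.closedPoint (WittVector p k)} := by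
  let φ := algebraMap (WittVector p k) (wittQuot p k n)
  have hrange : Set.range (thickeningι 𝒳 n).base =
      𝒳.hom.base ⁻¹' Set.range (Spec.map (CommRingCat.ofHom φ)).base :=
    Scheme.Pullback.range_fst 𝒳.hom (Spec.map (CommRingCat.ofHom φ))
  -- the points of `Spec W` hit by `Spec W_n`: exactly the closed point
  have hφ : ∀ s : PrimeSpectrum (wittQuot p k n),
      PrimeSpectrum.comap φ s = IsLocalRing.closedPoint (WittVector p k) := by
    intro s
    refine asIdeal_eq_closedPoint_of_mem _ ?_
    rw [PrimeSpectrum.comap_asIdeal, Ideal.mem_comap]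
    refine Ideal.IsPrime.mem_of_pow_mem inferInstance n ?_
    rw [← map_pow, show φ ((p : WittVector p k) ^ n) = 0 from
      (Ideal.Quotient.eq_zero_iff_mem.mpr (Ideal.pow_mem_pow (Ideal.mem_span_singleton_self _) n))]
    exact Ideal.zero_mem _
  have hsurj : IsLocalRing.closedPoint (WittVector p k) ∈ Set.range (PrimeSpectrum.comap φ) := by
    rw [range_comap_of_surjective _ φ Ideal.Quotient.mk_surjective, PrimeSpectrum.mem_zeroLocus,
      SetLike.coe_subset_coe, show RingHom.ker φ = Ideal.span {(p : WittVector p k)} ^ n from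
        Ideal.mk_ker]
    exact (Ideal.pow_le_self hn).trans ((Ideal.span_singleton_le_iff_mem _).mpr
      natCast_p_mem_closedPoint)
  rw [hrange]
  ext y
  simp only [Set.mem_preimage, Set.mem_range]
  constructor
  · rintro ⟨s, hs⟩
    rw [← hs]
    exact hφ s
  · intro hy
    obtain ⟨s, hs⟩ := hsurj
    exact ⟨s, hs.trans hy.symm⟩

/-- A `W`-morphism respects the special fibres. [cite: GortzWedhorn2023, proof of Thm. 24.94 and Prop. 24.95 (pp. 566–567), auxiliary step] -/
theorem base_mem_range_thickeningι_iff {𝒳' : SchemeOver (WittVector p k)} (ρ : 𝒳' ⟶ 𝒳)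
    {n : ℕ} (hn : n ≠ 0) (y : 𝒳'.left) :
    ρ.left.base y ∈ Set.range (thickeningι 𝒳 n).base ↔
      y ∈ Set.range (thickeningι 𝒳' n).base := by
  rw [range_thickeningι 𝒳 hn, range_thickeningι 𝒳' hn, Set.mem_preimage, Set.mem_preimage]
  have hw : 𝒳.hom.base (ρ.left.base y) = 𝒳'.hom.base y := by
    change (ρ.left ≫ 𝒳.hom).base y = _
    rw [Over.w ρ]
  rw [hw]

/-! ### Properness over `W` -/

/-- **GW II Lemma 24.96** (points form): for `𝒳` proper over `W = W(k)`, a closed subset of `𝒳`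
containing no point of the special fibre is empty (`𝒳 → Spec W` is a closed map and every point
of `Spec W` specialises to the closed point). [cite: GortzWedhorn2023, proof of Thm. 24.94 and Prop. 24.95 (pp. 566–567), auxiliary step] -/
theorem eq_empty_of_isClosed_of_forall_ne_closedPoint [IsProper 𝒳.hom] (C : Set 𝒳.left)
    (hC : IsClosed C)
    (h : ∀ y ∈ C, 𝒳.hom.base y ≠ IsLocalRing.closedPoint (WittVector p k)) : C = ∅ := by
  by_contra hne
  obtain ⟨c, hc⟩ := Set.nonempty_iff_ne_empty.mpr hne
  have himg : IsClosed (𝒳.hom.base '' C) := 𝒳.hom.isClosedMap C hC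
  have hmem : IsLocalRing.closedPoint (WittVector p k) ∈ 𝒳.hom.base '' C :=
    (IsLocalRing.specializes_closedPoint (𝒳.hom.base c)).mem_closed himg ⟨c, hc, rfl⟩
  obtain ⟨c', hc', hc'eq⟩ := hmem
  exact h c' hc' hc'eq

/-- `𝒳` proper over `W` is locally Noetherian: functions on affine opens form Noetherian rings. [cite: GortzWedhorn2023, proof of Thm. 24.94 and Prop. 24.95 (pp. 566–567), auxiliary step] -/
theorem isNoetherianRing_sections [IsProper 𝒳.hom] {V : 𝒳.left.Opens} (hV : IsAffineOpen V) :
    IsNoetherianRing Γ(𝒳.left, V) := by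
  haveI : IsLocallyNoetherian 𝒳.left := LocallyOfFiniteType.isLocallyNoetherian 𝒳.hom
  exact IsLocallyNoetherian.component_noetherian ⟨V, hV⟩

end Points

section PointsNoPerfect

variable {p : ℕ} [Fact p.Prime] {k : Type u} [Field k] (𝒳 : SchemeOver (WittVector p k))

/-- **`p` is not a unit in the local rings of `𝒳` at the points of the special fibre.** [cite: GortzWedhorn2023, proof of Thm. 24.94 and Prop. 24.95 (pp. 566–567), auxiliary step] -/
theorem not_isUnit_germ_natCast_p {n : ℕ} {x : 𝒳.left}
    (hx : x ∈ Set.range (thickeningι 𝒳 n).base) {U : 𝒳.left.Opens} (hxU : x ∈ U) :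
    ¬ IsUnit (𝒳.left.presheaf.germ U x hxU (p : Γ(𝒳.left, U))) := by
  obtain ⟨z, rfl⟩ := hx
  intro hu
  have hu' := (hu.pow n).map ((thickeningι 𝒳 n).stalkMap z).hom
  rw [← map_pow, Scheme.Hom.germ_stalkMap_apply, map_pow, map_natCast, ← Nat.cast_pow,
    natCast_pow_eq_zero_thickening, map_zero] at hu'
  exact not_isUnit_zero hu'

/-- At a point of the special fibre, a function which is invertible modulo `p` is invertible:
if `h b = 1 + p c` over `U ∋ x` then `x ∈ D(h)`. [cite: GortzWedhorn2023, proof of Thm. 24.94 and Prop. 24.95 (pp. 566–567), auxiliary step] -/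
theorem mem_basicOpen_of_mul_eq_one_add_p_mul {n : ℕ} {x : 𝒳.left}
    (hx : x ∈ Set.range (thickeningι 𝒳 n).base) {U : 𝒳.left.Opens} (hxU : x ∈ U)
    {h b c : Γ(𝒳.left, U)} (e : h * b = 1 + (p : Γ(𝒳.left, U)) * c) :
    x ∈ 𝒳.left.basicOpen h := by
  rw [Scheme.mem_basicOpen (hx := hxU)]
  have hp : 𝒳.left.presheaf.germ U x hxU (p : Γ(𝒳.left, U)) ∈
      IsLocalRing.maximalIdeal (𝒳.left.presheaf.stalk x) :=
    (IsLocalRing.mem_maximalIdeal _).mpr (not_isUnit_germ_natCast_p 𝒳 hx hxU)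
  have hunit : IsUnit (𝒳.left.presheaf.germ U x hxU (1 + (p : Γ(𝒳.left, U)) * c)) := by
    rw [map_add, map_one, map_mul, ← sub_neg_eq_add]
    refine IsLocalRing.isUnit_one_sub_self_of_mem_nonunits _ ?_
    exact (IsLocalRing.mem_maximalIdeal _).mp (neg_mem (Ideal.mul_mem_right _ _ hp))
  rw [← e, map_mul] at hunit
  exact isUnit_of_mul_isUnit_left hunit

/-- `𝒳` proper over `W` is quasi-compact. [cite: GortzWedhorn2023, proof of Thm. 24.94 and Prop. 24.95 (pp. 566–567), auxiliary step] -/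
theorem compactSpace_left [IsProper 𝒳.hom] : CompactSpace 𝒳.left :=
  QuasiCompact.compactSpace_of_compactSpace 𝒳.hom

end PointsNoPerfect

/-! ### Registered sub-goal -/

/-- **Registered sub-goal** (helper stub of `stub_pushforwardTransport`, universe `0`): GW II Lemma
24.96 in points form — for `𝒳` proper over `W(k)`, a closed subset of `𝒳` containing no point over
the closed point of `Spec W(k)` is empty (`eq_empty_of_isClosed_of_forall_ne_closedPoint`). [cite: GortzWedhorn2023, proof of Thm. 24.94 and Prop. 24.95 (pp. 566–567), auxiliary step] -/
theorem stub_properSpecialFibreClosed :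
    ∀ (p : ℕ) [Fact p.Prime] (k : Type) [Field k] [CharP k p] [PerfectRing k p]
      (𝒳 : Literature.AlgebraicGeometry.Motives.SchemeOver (WittVector p k)),
      AlgebraicGeometry.IsProper 𝒳.hom → ∀ (C : Set 𝒳.left), IsClosed C →
        (∀ y ∈ C, 𝒳.hom.base y ≠ IsLocalRing.closedPoint (WittVector p k)) → C = ∅ :=
  fun _ _ _ _ _ _ 𝒳 _ C hC h => eq_empty_of_isClosed_of_forall_ne_closedPoint 𝒳 C hC h

end Literature.AlgebraicGeometry.FormalGeometry.WittGrothendieckExistence.FormalVectorBundlesAlgebraize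

end
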